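import Mathlib
import Literature.MathematicalPhysics.QuantumLattice.WilsonDiracAP
import Literature.MathematicalPhysics.QuantumLattice.OverlapLocality
import Summits.QuantumFields.QCD.Theorems.QuarksAsStableActionDefs
import Summits.QuantumFields.QCD.Theorems.QuarksAsStableActionUnquenchedChessboardBoundHeavyFloor
import HarnessLib

/-!
# Positivity and the floor for bond-diluted Wilson–Dirac operators (crux stmt-QuantumFields-9735, line `Sketch`)

Helper toward the lead's stub `stub_signedFloor` (the floor on the SIGNED partition function via
reflection-positivity peeling): the TERMINAL and REFERENCE determinants of the peeling are
determinants of bond-diluted operators `bondWilsonDirac ρ E U m 1` (`QuarksAsStableActionDefs`)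
whose bonds lie in few directions (single time slices, the two reflection planes: spatial bonds
only). For those:

* `bondHop ρ E U μ` — the masked Wilson hopping matrix `W^E_μ = F^E_μ ⊗ P⁻_μ + (F^E_μ)ᴴ ⊗ P⁺_μ`
  (`F^E_μ = M_E F_μ`, the tree's twisted shift `linkHop` with the rows of absent bonds deleted), and
  `bondWilsonDirac ρ E U m 1 = (m+4)·1 - Σ_μ W^E_μ` (`bondWilsonDirac_eq_sub_sum_bondHop`);
* **contraction** `‖W^E_μ‖ ≤ 1` (`l2_opNorm_bondHop_le`: `W^Eᴴ W^E` is a Hermitian idempotent),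
  hence `‖Σ_μ W^E_μ‖ ≤ |S|` when the bonds of `E` lie in the directions `S`;
* **positivity** `det D_E(U, m, 1) > 0` whenever `|S| < m + 4` (`det_bondWilsonDirac_re_pos`; the
  tree's homotopy argument of `WilsonPositivityDomain` with `|S|` in place of `4`), the Neumann
  bound `‖D_E⁻¹‖ ≤ (m + 4 - |S|)⁻¹` and the **floor** `(m + 4 - |S|)ⁿ ≤ Re det D_E(U, m, 1)`
  (`pow_le_re_det_bondWilsonDirac`, e.g. `(m+1)ⁿ` for spatial bond sets, `m > -1`); `|det D_E| ≤ (|m+4| + 4)ⁿ`.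

References: Lüscher, CMP 54 (1977) 283; Montvay–Münster (1994) §4.2.3; Seiler, LNP 159. All proved.
-/

noncomputable section

open Matrix Complex Finset
open Literature.MathematicalPhysics.QuantumFieldTheory Literature.MathematicalPhysics.QuantumLattice
open Literature.Probability.LatticeModels
open scoped ComplexConjugate BigOperators

namespace Summit.QuantumFields.QCD.Theorems.QuarksAsStableAction

section Hop

open scoped Kronecker

variable {L N : ℕ} {G : Type*} [Group G] (ρ : G →* Matrix (Fin N) (Fin N) ℂ)

/-- The bond-masked `U`-twisted forward shift in direction `μ`: `linkHop` with the rows of absent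
bonds deleted. -/
def bondLinkHop (E : Finset (Edge 4 L)) (U : GaugeConfig 4 L G) (μ : Fin 4) :
    Matrix (TorusSite 4 L × Fin N) (TorusSite 4 L × Fin N) ℂ :=
  Matrix.of fun p q => if q.1 = Site.shift p.1 μ ∧ (p.1, μ) ∈ E then ρ (U (p.1, μ)) p.2 q.2 else 0

/-- The bond-masked Wilson hopping matrix in direction `μ` (`r = 1`):
`W^E_μ = F^E_μ ⊗ P⁻_μ + (F^E_μ)ᴴ ⊗ P⁺_μ`. -/
def bondHop (E : Finset (Edge 4 L)) (U : GaugeConfig 4 L G) (μ : Fin 4) :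
    Matrix (TorusSite 4 L × Fin N × Fin 4) (TorusSite 4 L × Fin N × Fin 4) ℂ :=
  Matrix.reindex (Equiv.prodAssoc _ _ _) (Equiv.prodAssoc _ _ _)
    (bondLinkHop ρ E U μ ⊗ₖ chiralProjMinus μ + (bondLinkHop ρ E U μ)ᴴ ⊗ₖ chiralProjPlus μ)

/-- **The diluted operator as mass term minus masked hopping terms** (`r = 1`, unitary `ρ`):
`bondWilsonDirac ρ E U m 1 = (m + 4)·1 − Σ_μ W^E_μ`. -/
theorem bondWilsonDirac_eq_sub_sum_bondHop (hρ : ∀ g, ρ g ∈ Matrix.unitaryGroup (Fin N) ℂ)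
    (E : Finset (Edge 4 L)) (U : GaugeConfig 4 L G) (m : ℝ) :
    bondWilsonDirac ρ E U m 1 =
      ((m + 4 : ℝ) : ℂ) • (1 : Matrix _ _ ℂ) - ∑ μ, bondHop ρ E U μ := by
  ext p q
  simp only [bondWilsonDirac, bondHop, bondLinkHop, chiralProjMinus, chiralProjPlus,
    ← star_rep_eq_rep_inv ρ hρ, Matrix.star_apply,
    Matrix.of_apply, Matrix.sub_apply, Matrix.smul_apply, Matrix.sum_apply, Matrix.reindex_apply,
    Matrix.submatrix_apply, Equiv.prodAssoc_symm_apply, Matrix.add_apply,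
    Matrix.kroneckerMap_apply, conjTranspose_apply, Matrix.one_apply, smul_eq_mul]
  simp only [star_ite_zero, Finset.mul_sum]
  congr 1
  · split_ifs <;> push_cast <;> ring
  · refine Finset.sum_congr rfl fun μ _ => ?_
    simp only [Complex.ofReal_one]
    split_ifs <;> ring

/-! ### The masked hopping matrices are contractions -/

variable [NeZero L]

/-- The row mask of the bond set in direction `μ`: the diagonal `0/1` matrix on site × colour
selecting the sites `x` with `(x, μ) ∈ E`. -/
def bondMask (E : Finset (Edge 4 L)) (μ : Fin 4) :
    Matrix (TorusSite 4 L × Fin N) (TorusSite 4 L × Fin N) ℂ :=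
  Matrix.diagonal fun p => if (p.1, μ) ∈ E then 1 else 0

omit [Group G] in
/-- The mask is idempotent. -/
theorem bondMask_mul_bondMask (E : Finset (Edge 4 L)) (μ : Fin 4) :
    bondMask (N := N) E μ * bondMask (N := N) E μ = bondMask (N := N) E μ := by
  rw [bondMask, diagonal_mul_diagonal]
  congr 1
  funext p
  by_cases h : (p.1, μ) ∈ E <;> simp [h]

omit [Group G] [NeZero L] in
/-- The mask is Hermitian. -/
theorem conjTranspose_bondMask (E : Finset (Edge 4 L)) (μ : Fin 4) :
    (bondMask (N := N) E μ)ᴴ = bondMask (N := N) E μ := by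
  rw [bondMask, diagonal_conjTranspose]
  congr 1
  funext p
  by_cases h : (p.1, μ) ∈ E <;> simp [h]

/-- The masked shift is the mask times the tree's twisted shift `linkHop`. -/
theorem bondLinkHop_eq_mask_mul (E : Finset (Edge 4 L)) (U : GaugeConfig 4 L G) (μ : Fin 4) :
    bondLinkHop ρ E U μ = bondMask (N := N) E μ * linkHop ρ U μ := by
  ext p q
  rw [bondMask, diagonal_mul]
  simp only [bondLinkHop, linkHop, Matrix.of_apply]
  by_cases h1 : q.1 = Site.shift p.1 μ <;> by_cases h2 : (p.1, μ) ∈ E <;> simp [h1, h2]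

/-- `W^Eᴴ W^E = Fᴴ M F ⊗ P⁻ + M ⊗ P⁺` (the cross terms vanish by `P⁻P⁺ = 0`; `F` unitary,
`M` the mask). -/
theorem conjTranspose_mul_bondHop (hρ : ∀ g, ρ g ∈ Matrix.unitaryGroup (Fin N) ℂ)
    (E : Finset (Edge 4 L)) (U : GaugeConfig 4 L G) (μ : Fin 4) :
    (bondHop ρ E U μ)ᴴ * bondHop ρ E U μ =
      Matrix.reindex (Equiv.prodAssoc _ _ _) (Equiv.prodAssoc _ _ _)
        (((linkHop ρ U μ)ᴴ * bondMask E μ * linkHop ρ U μ) ⊗ₖ chiralProjMinus μ +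
          bondMask E μ ⊗ₖ chiralProjPlus μ) := by
  have h2 := linkHop_mul_conjTranspose ρ hρ U μ
  have hM := bondMask_mul_bondMask (N := N) E μ
  have hMH := conjTranspose_bondMask (N := N) E μ
  rw [bondHop, bondLinkHop_eq_mask_mul, Matrix.reindex_apply, Matrix.conjTranspose_submatrix,
    Matrix.submatrix_mul_equiv, conjTranspose_add, conjTranspose_kronecker, conjTranspose_kronecker,
    conjTranspose_conjTranspose, chiralProjMinus_conjTranspose, chiralProjPlus_conjTranspose,
    conjTranspose_mul, hMH, add_mul, mul_add, mul_add, ← mul_kronecker_mul, ← mul_kronecker_mul,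
    ← mul_kronecker_mul, ← mul_kronecker_mul, chiralProjMinus_mul_self,
    chiralProjMinus_mul_chiralProjPlus, chiralProjPlus_mul_chiralProjMinus, chiralProjPlus_mul_self,
    kronecker_zero, kronecker_zero, add_zero, zero_add, Matrix.reindex_apply]
  congr 2
  · rw [Matrix.mul_assoc, ← Matrix.mul_assoc (bondMask E μ), hM, ← Matrix.mul_assoc]
  · rw [Matrix.mul_assoc, ← Matrix.mul_assoc (linkHop ρ U μ), h2, Matrix.one_mul, hM]

/-- The Gram matrix `Q = W^Eᴴ W^E` is idempotent. -/
theorem conjTranspose_mul_bondHop_idem (hρ : ∀ g, ρ g ∈ Matrix.unitaryGroup (Fin N) ℂ)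
    (E : Finset (Edge 4 L)) (U : GaugeConfig 4 L G) (μ : Fin 4) :
    ((bondHop ρ E U μ)ᴴ * bondHop ρ E U μ) * ((bondHop ρ E U μ)ᴴ * bondHop ρ E U μ) =
      (bondHop ρ E U μ)ᴴ * bondHop ρ E U μ := by
  have h1 := conjTranspose_mul_linkHop ρ hρ U μ
  have h2 := linkHop_mul_conjTranspose ρ hρ U μ
  have hM := bondMask_mul_bondMask (N := N) E μ
  set A := (linkHop ρ U μ)ᴴ * bondMask E μ * linkHop ρ U μ with hA
  have hAA : A * A = A := by
    rw [hA]
    calc (linkHop ρ U μ)ᴴ * bondMask E μ * linkHop ρ U μ * ((linkHop ρ U μ)ᴴ * bondMask E μ * linkHop ρ U μ)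
        = (linkHop ρ U μ)ᴴ * bondMask E μ * (linkHop ρ U μ * (linkHop ρ U μ)ᴴ) * bondMask E μ *
            linkHop ρ U μ := by simp only [Matrix.mul_assoc]
      _ = _ := by rw [h2, Matrix.mul_one, Matrix.mul_assoc _ (bondMask E μ) (bondMask E μ), hM]
  rw [conjTranspose_mul_bondHop ρ hρ, Matrix.reindex_apply, Matrix.submatrix_mul_equiv, add_mul,
    mul_add, mul_add, ← mul_kronecker_mul, ← mul_kronecker_mul, ← mul_kronecker_mul,
    ← mul_kronecker_mul, chiralProjMinus_mul_self, chiralProjMinus_mul_chiralProjPlus,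
    chiralProjPlus_mul_chiralProjMinus, chiralProjPlus_mul_self, kronecker_zero, kronecker_zero,
    add_zero, zero_add, hAA, hM]

/-- The Gram matrix `Q = W^Eᴴ W^E` is Hermitian. -/
theorem conjTranspose_mul_bondHop_conjTranspose (E : Finset (Edge 4 L)) (U : GaugeConfig 4 L G)
    (μ : Fin 4) :
    ((bondHop ρ E U μ)ᴴ * bondHop ρ E U μ)ᴴ = (bondHop ρ E U μ)ᴴ * bondHop ρ E U μ := by
  rw [conjTranspose_mul, conjTranspose_conjTranspose]

open scoped Matrix.Norms.L2Operator in
/-- A Hermitian idempotent has `ℓ²` operator norm at most `1`. -/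
theorem l2_opNorm_le_one_of_idem {n : Type*} [Fintype n] [DecidableEq n] (Q : Matrix n n ℂ)
    (hQ : Qᴴ = Q) (hQQ : Q * Q = Q) : ‖Q‖ ≤ 1 := by
  have h : ‖Q‖ * ‖Q‖ = ‖Q‖ := by
    rw [← CStarRing.norm_star_mul_self, star_eq_conjTranspose, hQ, hQQ]
  nlinarith [norm_nonneg Q]

open scoped Matrix.Norms.L2Operator in
/-- **Each masked hopping matrix is a contraction**: `‖W^E_μ‖ ≤ 1`. -/
theorem l2_opNorm_bondHop_le (hρ : ∀ g, ρ g ∈ Matrix.unitaryGroup (Fin N) ℂ)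
    (E : Finset (Edge 4 L)) (U : GaugeConfig 4 L G) (μ : Fin 4) : ‖bondHop ρ E U μ‖ ≤ 1 := by
  have hQ := l2_opNorm_le_one_of_idem _ (conjTranspose_mul_bondHop_conjTranspose ρ E U μ)
    (conjTranspose_mul_bondHop_idem ρ hρ E U μ)
  have hsq : ‖bondHop ρ E U μ‖ * ‖bondHop ρ E U μ‖ ≤ 1 := by
    rw [← CStarRing.norm_star_mul_self, star_eq_conjTranspose]
    exact hQ
  nlinarith [norm_nonneg (bondHop ρ E U μ)]

omit [NeZero L] in
/-- A direction without bonds contributes nothing. -/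
theorem bondHop_eq_zero_of_forall_not_mem (E : Finset (Edge 4 L)) (U : GaugeConfig 4 L G) (μ : Fin 4)
    (hE : ∀ x, (x, μ) ∉ E) : bondHop ρ E U μ = 0 := by
  have h0 : bondLinkHop ρ E U μ = 0 := by
    ext p q
    simp [bondLinkHop, hE p.1]
  rw [bondHop, h0, conjTranspose_zero, zero_kronecker, zero_kronecker, add_zero]
  simp

open scoped Matrix.Norms.L2Operator in
/-- **Norm of the total masked hopping**: if `E` has bonds in at most the directions of `S`, then
`‖Σ_μ W^E_μ‖ ≤ |S|`. -/
theorem l2_opNorm_sum_bondHop_le (hρ : ∀ g, ρ g ∈ Matrix.unitaryGroup (Fin N) ℂ)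
    (E : Finset (Edge 4 L)) (U : GaugeConfig 4 L G) (S : Finset (Fin 4))
    (hS : ∀ e ∈ E, e.2 ∈ S) : ‖∑ μ, bondHop ρ E U μ‖ ≤ S.card := by
  have hzero : ∀ μ ∉ S, bondHop ρ E U μ = 0 := fun μ hμ =>
    bondHop_eq_zero_of_forall_not_mem ρ E U μ fun x hx => hμ (hS _ hx)
  have hsum : ∑ μ, bondHop ρ E U μ = ∑ μ ∈ S, bondHop ρ E U μ := by
    rw [← Finset.sum_subset (Finset.subset_univ S)]
    intro μ _ hμ
    exact hzero μ hμ
  rw [hsum]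
  calc ‖∑ μ ∈ S, bondHop ρ E U μ‖ ≤ ∑ μ ∈ S, ‖bondHop ρ E U μ‖ := norm_sum_le _ _
    _ ≤ ∑ _μ ∈ S, (1 : ℝ) := Finset.sum_le_sum fun μ _ => l2_opNorm_bondHop_le ρ hρ E U μ
    _ = S.card := by simp

end Hop

/-! ## Positivity and the floor for operators hopping in fewer than `m + 4` directions -/

section Floor

open scoped Matrix.Norms.L2Operator

variable {L N : ℕ} [NeZero L] {G : Type*} [Group G] (ρ : G →* Matrix (Fin N) (Fin N) ℂ)

/-- Along the hopping homotopy `M_t = 1 - (t/(m+4)) K^E`, `t ∈ [0,1]`, the matrix is a unit as soon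
as the bonds of `E` lie in a set `S` of directions with `|S| < m + 4` (Neumann series,
`‖K^E‖ ≤ |S|`). -/
theorem isUnit_bondSegMatrix (hρ : ∀ g, ρ g ∈ Matrix.unitaryGroup (Fin N) ℂ)
    (E : Finset (Edge 4 L)) (U : GaugeConfig 4 L G) (S : Finset (Fin 4)) (hS : ∀ e ∈ E, e.2 ∈ S)
    {m t : ℝ} (hm : (S.card : ℝ) < m + 4) (ht0 : 0 ≤ t) (ht1 : t ≤ 1) :
    IsUnit (1 - ((t / (m + 4) : ℝ) : ℂ) • ∑ μ, bondHop ρ E U μ) := by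
  have hK := l2_opNorm_sum_bondHop_le ρ hρ E U S hS
  have hm4 : 0 < m + 4 := lt_of_le_of_lt (Nat.cast_nonneg _) hm
  have hnorm : ‖((t / (m + 4) : ℝ) : ℂ) • ∑ μ, bondHop ρ E U μ‖ < 1 := by
    rw [norm_smul, Complex.norm_real, Real.norm_eq_abs, abs_of_nonneg (by positivity)]
    calc t / (m + 4) * ‖∑ μ, bondHop ρ E U μ‖ ≤ 1 / (m + 4) * S.card := by
          apply mul_le_mul _ hK (norm_nonneg _) (by positivity)
          exact div_le_div_of_nonneg_right ht1 hm4.le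
      _ < 1 := by
          rw [div_mul_eq_mul_div, one_mul, div_lt_one hm4]; exact hm
  exact ⟨Units.oneSub _ hnorm, rfl⟩

omit [NeZero L] in
/-- For `t > 0` the homotopy matrix is a rescaled diluted operator at the larger bare mass
`(m+4)/t - 4`. -/
theorem bondSegMatrix_eq_smul (hρ : ∀ g, ρ g ∈ Matrix.unitaryGroup (Fin N) ℂ) [NeZero L]
    (E : Finset (Edge 4 L)) (U : GaugeConfig 4 L G) {m t : ℝ} (hm4 : 0 < m + 4) (ht : 0 < t) :
    (1 - ((t / (m + 4) : ℝ) : ℂ) • ∑ μ, bondHop ρ E U μ) =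
      ((t / (m + 4) : ℝ) : ℂ) • bondWilsonDirac ρ E U ((m + 4) / t - 4) 1 := by
  have hm4' : (m + 4) ≠ 0 := hm4.ne'
  rw [bondWilsonDirac_eq_sub_sum_bondHop ρ hρ, smul_sub, smul_smul, ← Complex.ofReal_mul,
    show t / (m + 4) * ((m + 4) / t - 4 + 4) = 1 by field_simp; ring, Complex.ofReal_one, one_smul]

/-- `det M_t` is real. -/
theorem det_bondSegMatrix_im (hρ : ∀ g, ρ g ∈ Matrix.unitaryGroup (Fin N) ℂ)
    (E : Finset (Edge 4 L)) (U : GaugeConfig 4 L G) {m t : ℝ} (hm4 : 0 < m + 4) (ht0 : 0 ≤ t) :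
    (((1 - ((t / (m + 4) : ℝ) : ℂ) • ∑ μ, bondHop ρ E U μ)).det).im = 0 := by
  rcases ht0.eq_or_lt with h | ht
  · subst h; simp
  · rw [bondSegMatrix_eq_smul ρ hρ E U hm4 ht, det_smul]
    have hreal := det_bondWilsonDirac_im ρ hρ E U ((m + 4) / t - 4) 1
    set d := (bondWilsonDirac ρ E U ((m + 4) / t - 4) 1).det with hd
    have hd' : d = ((d.re : ℝ) : ℂ) := Complex.ext (by simp) (by simpa using hreal)
    rw [hd', ← Complex.ofReal_pow, ← Complex.ofReal_mul, Complex.ofReal_im]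

omit [NeZero L] in
/-- `t ↦ det M_t` is continuous. -/
theorem continuous_det_bondSegMatrix [NeZero L] (E : Finset (Edge 4 L)) (U : GaugeConfig 4 L G) (m : ℝ) :
    Continuous fun t : ℝ => ((1 - ((t / (m + 4) : ℝ) : ℂ) • ∑ μ, bondHop ρ E U μ)).det := by
  have h : Continuous fun t : ℝ => (1 - ((t / (m + 4) : ℝ) : ℂ) • ∑ μ, bondHop ρ E U μ) := by
    refine continuous_const.sub ?_
    have h1 : Continuous fun t : ℝ => ((t / (m + 4) : ℝ) : ℂ) :=
      Complex.continuous_ofReal.comp (continuous_id.div_const (m + 4))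
    exact h1.smul continuous_const
  exact h.matrix_det

/-- **Positivity of the diluted Wilson determinant** when the bonds lie in a set `S` of directions
with `|S| < m + 4` (e.g. spatial bonds only and `m > -1`, or all bonds and `m > 0`): for every gauge
field `det D_E(U, m, 1) > 0` — real, continuous and non-zero along the homotopy, `1` at `t = 0`. -/
theorem det_bondWilsonDirac_re_pos (hρ : ∀ g, ρ g ∈ Matrix.unitaryGroup (Fin N) ℂ)
    (E : Finset (Edge 4 L)) (U : GaugeConfig 4 L G) (S : Finset (Fin 4)) (hS : ∀ e ∈ E, e.2 ∈ S)
    {m : ℝ} (hm : (S.card : ℝ) < m + 4) :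
    0 < ((bondWilsonDirac ρ E U m 1).det).re := by
  have hm4 : 0 < m + 4 := lt_of_le_of_lt (Nat.cast_nonneg _) hm
  set g : ℝ → ℝ := fun t => (((1 - ((t / (m + 4) : ℝ) : ℂ) • ∑ μ, bondHop ρ E U μ)).det).re
    with hgdef
  have hg : Continuous g := Complex.continuous_re.comp (continuous_det_bondSegMatrix ρ E U m)
  have hg0 : g 0 = 1 := by simp [hgdef]
  have hne : ∀ t ∈ Set.Icc (0 : ℝ) 1, g t ≠ 0 := by
    intro t ht h0
    apply ((Matrix.isUnit_iff_isUnit_det _).mp (isUnit_bondSegMatrix ρ hρ E U S hS hm ht.1 ht.2)).ne_zero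
    exact Complex.ext (by simpa [hgdef] using h0) (by simpa using det_bondSegMatrix_im ρ hρ E U hm4 ht.1)
  have hg1 : 0 < g 1 := by
    refine lt_of_not_ge fun hle => ?_
    have hmem : (0 : ℝ) ∈ Set.Icc (g 1) (g 0) := ⟨hle, by rw [hg0]; norm_num⟩
    obtain ⟨t, ht, ht0⟩ := intermediate_value_Icc' zero_le_one hg.continuousOn hmem
    exact hne t ht ht0
  have hD : bondWilsonDirac ρ E U m 1 =
      ((m + 4 : ℝ) : ℂ) • (1 - ((1 / (m + 4) : ℝ) : ℂ) • ∑ μ, bondHop ρ E U μ) := by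
    rw [smul_sub, smul_smul, ← Complex.ofReal_mul,
      show (m + 4) * (1 / (m + 4)) = 1 by field_simp, Complex.ofReal_one, one_smul,
      bondWilsonDirac_eq_sub_sum_bondHop ρ hρ]
  have hdet : (bondWilsonDirac ρ E U m 1).det =
      (((m + 4) ^ Fintype.card (TorusSite 4 L × Fin N × Fin 4) * g 1 : ℝ) : ℂ) := by
    rw [hD, det_smul]
    have him := det_bondSegMatrix_im ρ hρ E U hm4 zero_le_one
    set d := ((1 - ((1 / (m + 4) : ℝ) : ℂ) • ∑ μ, bondHop ρ E U μ)).det with hd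
    have hd' : d = ((d.re : ℝ) : ℂ) := Complex.ext (by simp) (by simpa using him)
    rw [hd', ← Complex.ofReal_pow, ← Complex.ofReal_mul]
  rw [hdet, Complex.ofReal_re]
  positivity

/-- **Neumann bound on the diluted propagator**: `‖D_E(U,m,1)⁻¹‖ ≤ (m + 4 - |S|)⁻¹`. -/
theorem norm_inv_bondWilsonDirac_le (hρ : ∀ g, ρ g ∈ Matrix.unitaryGroup (Fin N) ℂ)
    (E : Finset (Edge 4 L)) (U : GaugeConfig 4 L G) (S : Finset (Fin 4)) (hS : ∀ e ∈ E, e.2 ∈ S)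
    {m : ℝ} (hm : (S.card : ℝ) < m + 4) :
    ‖(bondWilsonDirac ρ E U m 1)⁻¹‖ ≤ (m + 4 - S.card)⁻¹ := by
  have hm4 : (0 : ℝ) < m + 4 := lt_of_le_of_lt (Nat.cast_nonneg _) hm
  have hgap : (0 : ℝ) < m + 4 - S.card := by linarith
  set x : Matrix (TorusSite 4 L × Fin N × Fin 4) (TorusSite 4 L × Fin N × Fin 4) ℂ :=
    ((1 / (m + 4) : ℝ) : ℂ) • ∑ μ, bondHop ρ E U μ with hx
  have hxnorm : ‖x‖ ≤ S.card / (m + 4) := by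
    rw [hx, norm_smul, Complex.norm_real, Real.norm_eq_abs, abs_of_nonneg (by positivity)]
    calc 1 / (m + 4) * ‖∑ μ, bondHop ρ E U μ‖ ≤ 1 / (m + 4) * S.card := by
          gcongr
          exact l2_opNorm_sum_bondHop_le ρ hρ E U S hS
      _ = S.card / (m + 4) := by ring
  have hx1 : ‖x‖ < 1 := hxnorm.trans_lt (by rw [div_lt_one hm4]; exact hm)
  have hD : bondWilsonDirac ρ E U m 1 = ((m + 4 : ℝ) : ℂ) • (1 - x) := by
    rw [hx, smul_sub, smul_smul, ← Complex.ofReal_mul,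
      show (m + 4) * (1 / (m + 4)) = 1 by field_simp, Complex.ofReal_one, one_smul,
      bondWilsonDirac_eq_sub_sum_bondHop ρ hρ]
  set u := Units.oneSub x hx1 with hu
  set ui : Matrix (TorusSite 4 L × Fin N × Fin 4) (TorusSite 4 L × Fin N × Fin 4) ℂ :=
    (u⁻¹ : (Matrix (TorusSite 4 L × Fin N × Fin 4) (TorusSite 4 L × Fin N × Fin 4) ℂ)ˣ).val with hui
  have hinv1 : ‖ui‖ ≤ (1 - ‖x‖)⁻¹ := by
    have h := tsum_geometric_le_of_norm_lt_one x hx1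
    have hone : ‖(1 : Matrix (TorusSite 4 L × Fin N × Fin 4) (TorusSite 4 L × Fin N × Fin 4) ℂ)‖ ≤ 1 := by
      rw [Matrix.cstar_norm_def, map_one]
      exact ContinuousLinearMap.norm_id_le
    have huinv : ui = ∑' k : ℕ, x ^ k := rfl
    rw [huinv]
    linarith
  have hinvle : (1 - ‖x‖)⁻¹ ≤ (m + 4) / (m + 4 - S.card) := by
    have h1x : 0 < 1 - ‖x‖ := by linarith
    rw [inv_le_comm₀ h1x (by positivity)]
    calc ((m + 4) / (m + 4 - S.card))⁻¹ = (m + 4 - S.card) / (m + 4) := by rw [inv_div]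
      _ = 1 - S.card / (m + 4) := by field_simp
      _ ≤ 1 - ‖x‖ := by linarith
  have hunit : (1 - x) = (u : Matrix _ _ ℂ) := rfl
  have hDinv : (bondWilsonDirac ρ E U m 1)⁻¹ = (((m + 4)⁻¹ : ℝ) : ℂ) • ui := by
    refine Matrix.inv_eq_right_inv ?_
    rw [hD, hunit, hui, smul_mul_smul_comm, Units.mul_inv, ← Complex.ofReal_mul,
      mul_inv_cancel₀ hm4.ne', Complex.ofReal_one, one_smul]
  rw [hDinv, norm_smul, Complex.norm_real, Real.norm_eq_abs, abs_of_nonneg (by positivity)]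
  calc (m + 4)⁻¹ * ‖ui‖ ≤ (m + 4)⁻¹ * ((m + 4) / (m + 4 - S.card)) := by
        gcongr
        exact hinv1.trans hinvle
    _ = (m + 4 - S.card)⁻¹ := by field_simp

/-- **The floor on the diluted Wilson determinant**: if the bonds of `E` lie in a set `S` of
directions with `|S| < m + 4`, then `(m + 4 - |S|)ⁿ ≤ Re det D_E(U, m, 1)` for every gauge field
(`n` the matrix size; e.g. `(m+1)ⁿ` for spatial bond sets and `m > -1`). -/
theorem pow_le_re_det_bondWilsonDirac (hρ : ∀ g, ρ g ∈ Matrix.unitaryGroup (Fin N) ℂ)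
    (E : Finset (Edge 4 L)) (U : GaugeConfig 4 L G) (S : Finset (Fin 4)) (hS : ∀ e ∈ E, e.2 ∈ S)
    {m : ℝ} (hm : (S.card : ℝ) < m + 4) :
    (m + 4 - S.card) ^ Fintype.card (TorusSite 4 L × Fin N × Fin 4) ≤
      ((bondWilsonDirac ρ E U m 1).det).re := by
  have hpos := det_bondWilsonDirac_re_pos ρ hρ E U S hS hm
  have hreal := det_bondWilsonDirac_eq_ofReal_re ρ hρ E U m 1
  have hnorm : ‖(bondWilsonDirac ρ E U m 1).det‖ = ((bondWilsonDirac ρ E U m 1).det).re := by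
    rw [hreal, Complex.norm_real, Complex.ofReal_re, Real.norm_eq_abs, abs_of_pos hpos]
  rw [← hnorm]
  have hunit : IsUnit (bondWilsonDirac ρ E U m 1).det := by
    rw [isUnit_iff_ne_zero]
    intro h0
    have : ((bondWilsonDirac ρ E U m 1).det).re = 0 := by rw [h0, Complex.zero_re]
    linarith
  have hgap : (0 : ℝ) < m + 4 - S.card := by linarith
  have hinv : ‖(bondWilsonDirac ρ E U m 1)⁻¹‖ ≤ (m + 4 - S.card)⁻¹ :=
    norm_inv_bondWilsonDirac_le ρ hρ E U S hS hm
  exact UnquenchedChessboardBoundLine.pow_le_norm_det_of_norm_inv_le _ hunit hgap hinv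

/-- **Upper bound**: `|det D_E(U,m,1)| ≤ (|m+4| + 4)ⁿ` for every bond set. -/
theorem norm_det_bondWilsonDirac_le (hρ : ∀ g, ρ g ∈ Matrix.unitaryGroup (Fin N) ℂ)
    (E : Finset (Edge 4 L)) (U : GaugeConfig 4 L G) (m : ℝ) :
    ‖(bondWilsonDirac ρ E U m 1).det‖ ≤ (|m + 4| + 4) ^ Fintype.card (TorusSite 4 L × Fin N × Fin 4) := by
  have hone : ‖(1 : Matrix (TorusSite 4 L × Fin N × Fin 4) (TorusSite 4 L × Fin N × Fin 4) ℂ)‖ ≤ 1 := by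
    rw [Matrix.cstar_norm_def, map_one]
    exact ContinuousLinearMap.norm_id_le
  have hnorm : ‖bondWilsonDirac ρ E U m 1‖ ≤ |m + 4| + 4 := by
    rw [bondWilsonDirac_eq_sub_sum_bondHop ρ hρ E U m]
    refine (norm_sub_le _ _).trans (add_le_add ?_ ?_)
    · rw [norm_smul, Complex.norm_real, Real.norm_eq_abs]
      calc |m + 4| * ‖(1 : Matrix _ _ ℂ)‖ ≤ |m + 4| * 1 := by gcongr
        _ = |m + 4| := mul_one _
    · have h := l2_opNorm_sum_bondHop_le ρ hρ E U Finset.univ (fun e _ => Finset.mem_univ _)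
      simpa using h
  exact (UnquenchedChessboardBoundLine.norm_det_le_opNorm_pow _).trans
    (pow_le_pow_left₀ (norm_nonneg _) hnorm _)

end Floor

end Summit.QuantumFields.QCD.Theorems.QuarksAsStableAction

end
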